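import Summits.MatrixMultiplication.OmegaCensus.ThreeSetLinePackedEnc
import Summits.MatrixMultiplication.OmegaCensus.ThreeSetLineUnitCertificate
import HarnessLib

/-!
# The certificate-free NORM FILTER for the three-set line identity, I: the checker (pure `ℕ`/`ℤ` definitions)

ω-census `pub-omega`, family (b3), seat pub-omega-group gen 41.  Framing: lottery ticket; floor = certified bounds/negative
ranges.  VALUE: a kernel TOOL for the three-set cube cells `(4, d, e)@p²`; NOT progress on ω, not a proof of LINE LEMMA (β).

For a killer `W` and an `X`-datum `F` the checker computes, with the packed group-ring primitives of
`ThreeSetLinePackedEnc` / `…Cyclotomic`, the numeral of `D_X = (xw̄)² + (xw̄)(x̄w) + (x̄w)²` and its half-norm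
`T(D_X) = ∏_{i<h} σ_{g^i}(D_X)` (`g` a primitive root mod `p`, `2h = p − 1`, tower schedule `st`), reads off the integer
`n = T(D_X)` (`isConst`/`readInt`), and does the same once per hole `s` for `Γ_s = w̄²ρ^{2s} − ww̄ + w²ρ^{−2s}` (the term
`−ww̄` realised as `ww̄ · J`, `J = Σ_{v ≥ 1} ρ^v = −1`, to stay non-negative), giving integers `m_s`.  Then `Nm D_X = n²`,
`Nm Γ_s = m_s²`, and `ThreeSetLineNormDivisibility.norm_dvd_of_line_identity3` forces `n ∣ m_s` for the hole `s` of any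
solution: a datum with `m_s mod n ≠ 0` for every `s` is dead WITHOUT a certificate; the few survivors carry `(ℓ, r)`
certificates (`ThreeSetLineUnitCertificate.datumChk`).  Reference checker `normBlock`; fast variants `normBlockF` (base
`X = 2^B`, digits by shifts, shared shift tables), `normBlockX` (`X`, `X^p` as evaluated numerals; the `m_s` tested through their
product), `normBlockL` (all per-theorem constants as literals).  Measured (farm, `p = 29`, `|X| = 5`): ≈ 20 ms per datum with
`normBlockX`, no certificate bytes; ≈ 0.1–0.3 % of the data are survivors.  Semantics and soundness:
`ThreeSetLineNormFilterLemmas`, `ThreeSetLineNormFilter`.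
-/

namespace Summit.MatrixMultiplication.OmegaCensus

open Finset LineInv

namespace LineNorm

/-! ## Definitions (pure `ℕ` / `ℤ`) -/

/-- The monomial `ρ^e` as a numeral: `X^e`, `e < p`. [folklore] -/
def unitN (X e : ℕ) : ℕ := enc X (List.replicate e 0 ++ [1])

/-- `J = Σ_{1 ≤ v < p} X^v` (image `Σ_{v≥1} ρ^v = −1`). [folklore] -/
def jN (p X : ℕ) : ℕ := enc X (0 :: List.replicate (p - 1) 1)

/-- The half-norm tower: `(T_k z, k)` following the schedule (`true`: `k ↦ 2k`, `false`: `k ↦ k + 1`). [folklore] -/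
def tower (p X gi : ℕ) : List Bool → ℕ → ℕ × ℕ
  | [], z => (z, 1)
  | true :: st, z =>
    let r := tower p X gi st z
    (cmul p X r.1 (perm p X (gi ^ r.2 % p) r.1), 2 * r.2)
  | false :: st, z =>
    let r := tower p X gi st z
    (cmul p X r.1 (perm p X (gi ^ r.2 % p) z), r.2 + 1)

/-- Discrete-log table check: `i ↦ g^i mod p` maps `[0, p−1)` into `[1, p)` with two-sided inverse `dlog`. [folklore] -/
def dlogChk (p g : ℕ) (dlog : List ℕ) : Bool :=
  ((List.range (p - 1)).all fun i => (1 ≤ g ^ i % p : Bool) && (dlog.getD (g ^ i % p) 0 == i)) &&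
  ((List.range (p - 1)).all fun j => (dlog.getD (j + 1) 0 < p - 1 : Bool) && (g ^ (dlog.getD (j + 1) 0) % p == j + 1))

/-- The numeral of `D_X` for the datum `F` (given the numerals `w`, `w̄`). [folklore] -/
def dNum (p X : ℕ) (w wc : ℕ) (F : List ℕ) : ℕ :=
  let x := ofList X F
  let xc := perm p X (p - 1) x
  let A := cmul p X x wc
  let B := cmul p X xc w
  cmul p X A A + cmul p X A B + cmul p X B B

/-- The (non-negative) numeral of `Γ_s` for the hole `s < p`. [folklore] -/
def gNum (p X : ℕ) (w wc : ℕ) (s : ℕ) : ℕ :=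
  cmul p X (cmul p X wc wc) (unitN X (2 * s % p)) + cmul p X (cmul p X w w) (unitN X (2 * (p - s) % p)) +
    cmul p X (cmul p X w wc) (jN p X)

/-- The integer `T`-value of a numeral, if the tower result reads as one. [folklore] -/
def tval (p X gi : ℕ) (st : List Bool) (z : ℕ) : Option ℤ :=
  if isConst p X (tower p X gi st z).1 then some (readInt X (tower p X gi st z).1) else none

/-- Per-datum norm test: `F` has length `p` and mass `d`, `n = T(D_X)` is read off, and `m mod n ≠ 0` for every `m ∈ ms`.
[folklore] -/
def normDatum (p X gi d : ℕ) (st : List Bool) (w wc : ℕ) (ms : List ℤ) (F : List ℕ) : Bool :=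
  (F.length == p) && (F.sum == d) &&
  match tval p X gi st (dNum p X w wc F) with
  | none => false
  | some n => ms.all fun m => m % n != 0

/-- Certificate lookup for the survivors. [folklore] -/
def excLookup (F : List ℕ) (exc : List (List ℕ × List (ℕ × ℕ × ℕ × ℕ))) : List (ℕ × ℕ × ℕ × ℕ) :=
  match exc.find? (fun e => e.1 == F) with
  | some e => e.2
  | none => []

/-- **The block checker.**  `X`: digit base; `g`, `gi`: primitive root mod `p` and its inverse; `dlog`: discrete logs;
`st`: tower schedule; `d`: the mass of the data; `W`: the killer; `Fs`: the data; `ms = [m_0, …, m_{p−1}]`: the claimed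
`T(Γ_s)`; `exc`: survivors with their `(ℓ, D, r₁, r₂)` certificates. [folklore] -/
def normBlock (p X g gi : ℕ) (dlog : List ℕ) (st : List Bool) (d : ℕ) (W : List ℕ) (Fs : List (List ℕ)) (ms : List ℤ)
    (exc : List (List ℕ × List (ℕ × ℕ × ℕ × ℕ))) : Bool :=
  let w := ofList X W
  let wc := perm p X (p - 1) w
  let h := (tower p X gi st 1).2
  (2 ≤ X : Bool) && (W.length == p) && (d < X : Bool) && (W.sum < X : Bool) && (g * gi % p == 1) &&
  dlogChk p g dlog && (2 * h == p - 1) &&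
  ((3 * (d * W.sum) ^ 2) ^ h < X : Bool) && ((W.sum ^ 2 * (p + 1)) ^ h < X : Bool) && (ms.length == p) &&
  ((List.range p).all fun s => tval p X gi st (gNum p X w wc s) == some (ms.getD s 0)) &&
  Fs.all fun F => normDatum p X gi d st w wc ms F || LineUnit.datumChk p W F (excLookup F exc)

/-! ### Fast variants (base `X = 2^B`: digits by shifts; shift tables shared per theorem) -/

/-- The shift table of the permutation `u ↦ gi·u`: entry `u` is `B·(gi·u mod p)`. [folklore] -/
def shifts (p B gi : ℕ) : List ℕ := (List.range p).map fun u => B * (gi * u % p)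

/-- Digit permutation through a shift table (one pass: shift, mask, Horner). [folklore] -/
def permF (B : ℕ) (es : List ℕ) (a : ℕ) : ℕ := es.foldr (fun sh acc => (a >>> sh) % 2 ^ B + 2 ^ B * acc) 0

/-- The shift tables along a tower schedule (same exponent bookkeeping as `tower`). [folklore] -/
def shiftsFor (p B gi : ℕ) : List Bool → List (List ℕ) × ℕ
  | [] => ([], 1)
  | true :: st =>
    let r := shiftsFor p B gi st
    (shifts p B (gi ^ r.2 % p) :: r.1, 2 * r.2)
  | false :: st =>
    let r := shiftsFor p B gi st
    (shifts p B (gi ^ r.2 % p) :: r.1, r.2 + 1)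

/-- The tower with precomputed shift tables (`ess` aligned with `st`). [folklore] -/
def towerF (p B : ℕ) : List (List ℕ) → List Bool → ℕ → ℕ
  | es :: ess, true :: st, z =>
    let r := towerF p B ess st z
    cmul p (2 ^ B) r (permF B es r)
  | es :: ess, false :: st, z =>
    let r := towerF p B ess st z
    cmul p (2 ^ B) r (permF B es z)
  | _, _, z => z

/-- Constancy of the digits `1 … p−1` by ONE comparison: `a div X = (digit 1) · Σ_{v<p−1} X^v`. [folklore] -/
def isConstF (p X a : ℕ) : Bool := a / X == (a / X % X) * enc X (List.replicate (p - 1) 1)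

/-- `tval` with the fast tower and constancy test. [folklore] -/
def tvalF (p B : ℕ) (ess : List (List ℕ)) (st : List Bool) (z : ℕ) : Option ℤ :=
  let t := towerF p B ess st z
  if isConstF p (2 ^ B) t then some (readInt (2 ^ B) t) else none

/-- Fast per-datum norm test. [folklore] -/
def normDatumF (p B d : ℕ) (ess : List (List ℕ)) (st : List Bool) (esr : List ℕ) (w wc : ℕ) (ms : List ℤ)
    (F : List ℕ) : Bool :=
  (F.length == p) && (F.sum == d) &&
  (let x := ofList (2 ^ B) F
   let xc := permF B esr x
   let A := cmul p (2 ^ B) x wc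
   let Bv := cmul p (2 ^ B) xc w
   match tvalF p B ess st (cmul p (2 ^ B) A A + cmul p (2 ^ B) A Bv + cmul p (2 ^ B) Bv Bv) with
   | none => false
   | some n => ms.all fun m => m % n != 0)

/-- **The fast block checker** (same parameters as `normBlock`, base `X = 2^B`). [folklore] -/
def normBlockF (p B g gi : ℕ) (dlog : List ℕ) (st : List Bool) (d : ℕ) (W : List ℕ) (Fs : List (List ℕ)) (ms : List ℤ)
    (exc : List (List ℕ × List (ℕ × ℕ × ℕ × ℕ))) : Bool :=
  let X := 2 ^ B
  let w := ofList X W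
  let esr := shifts p B (p - 1)
  let wc := permF B esr w
  let ess := (shiftsFor p B gi st).1
  let h := (shiftsFor p B gi st).2
  (2 ≤ X : Bool) && (W.length == p) && (d < X : Bool) && (W.sum < X : Bool) && (g * gi % p == 1) &&
  dlogChk p g dlog && (2 * h == p - 1) &&
  ((3 * (d * W.sum) ^ 2) ^ h < X : Bool) && ((W.sum ^ 2 * (p + 1)) ^ h < X : Bool) && (ms.length == p) &&
  ((List.range p).all fun s => tvalF p B ess st (gNum p X w wc s) == some (ms.getD s 0)) &&
  Fs.all fun F => normDatumF p B d ess st esr w wc ms F || LineUnit.datumChk p W F (excLookup F exc)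

/-! ### Literal-parameter variants (`X = 2^B` and `M = X^p` passed as evaluated numerals) -/

/-- Cyclic product with the modulus `M = X^p` precomputed. [folklore] -/
def cmulM (M a b : ℕ) : ℕ := a * b % M + a * b / M

/-- Digit permutation with the base `X` precomputed. [folklore] -/
def permX (X : ℕ) (es : List ℕ) (a : ℕ) : ℕ := es.foldr (fun sh acc => (a >>> sh) % X + X * acc) 0

/-- The tower with precomputed `X`, `M` and shift tables. [folklore] -/
def towerX (X M : ℕ) : List (List ℕ) → List Bool → ℕ → ℕ
  | es :: ess, true :: st, z =>
    let r := towerX X M ess st z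
    cmulM M r (permX X es r)
  | es :: ess, false :: st, z =>
    let r := towerX X M ess st z
    cmulM M r (permX X es z)
  | _, _, z => z

/-- `tval` with the literal-parameter tower. [folklore] -/
def tvalX (p X M : ℕ) (ess : List (List ℕ)) (st : List Bool) (z : ℕ) : Option ℤ :=
  let t := towerX X M ess st z
  if isConstF p X t then some (readInt X t) else none

/-- Literal-parameter per-datum norm test; the `m_s` are tested through their product `P` (`n ∣ m_s ⇒ n ∣ P`). [folklore] -/
def normDatumX (p X M d : ℕ) (ess : List (List ℕ)) (st : List Bool) (esr : List ℕ) (w wc : ℕ) (P : ℤ)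
    (F : List ℕ) : Bool :=
  (F.length == p) && (F.sum == d) &&
  (let x := ofList X F
   let xc := permX X esr x
   let A := cmulM M x wc
   let Bv := cmulM M xc w
   match tvalX p X M ess st (cmulM M A A + cmulM M A Bv + cmulM M Bv Bv) with
   | none => false
   | some n => P % n != 0)

/-- **The literal-parameter block checker** (`X`, `M` given as numerals and checked against `2^B`, `X^p`). [folklore] -/
def normBlockX (p B X M g gi : ℕ) (dlog : List ℕ) (st : List Bool) (d : ℕ) (W : List ℕ) (Fs : List (List ℕ))
    (ms : List ℤ) (exc : List (List ℕ × List (ℕ × ℕ × ℕ × ℕ))) : Bool :=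
  let w := ofList X W
  let esr := shifts p B (p - 1)
  let wc := permX X esr w
  let ess := (shiftsFor p B gi st).1
  let h := (shiftsFor p B gi st).2
  let P := ms.prod
  (X == 2 ^ B) && (M == X ^ p) &&
  (2 ≤ X : Bool) && (W.length == p) && (d < X : Bool) && (W.sum < X : Bool) && (g * gi % p == 1) &&
  dlogChk p g dlog && (2 * h == p - 1) &&
  ((3 * (d * W.sum) ^ 2) ^ h < X : Bool) && ((W.sum ^ 2 * (p + 1)) ^ h < X : Bool) && (ms.length == p) &&
  ((List.range p).all fun s => tvalX p X M ess st (gNum p X w wc s) == some (ms.getD s 0)) &&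
  Fs.all fun F => normDatumX p X M d ess st esr w wc P F || LineUnit.datumChk p W F (excLookup F exc)

/-- **The block checker with all per-theorem constants as literals** (`wL = ofList X W`, `wcL`, the shift tables
`esrL`, `essL`, the product `PL = ∏ ms` — each checked once, then used for every datum). [folklore] -/
def normBlockL (p B X M g gi : ℕ) (dlog : List ℕ) (st : List Bool) (d : ℕ) (W : List ℕ) (wL wcL : ℕ) (esrL : List ℕ)
    (essL : List (List ℕ)) (PL : ℤ) (Fs : List (List ℕ)) (ms : List ℤ) (exc : List (List ℕ × List (ℕ × ℕ × ℕ × ℕ))) :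
    Bool :=
  let h := (shiftsFor p B gi st).2
  (wL == ofList X W) && (esrL == shifts p B (p - 1)) && (wcL == permX X esrL wL) && (essL == (shiftsFor p B gi st).1) &&
  (PL == ms.prod) && (X == 2 ^ B) && (M == X ^ p) &&
  (2 ≤ X : Bool) && (W.length == p) && (d < X : Bool) && (W.sum < X : Bool) && (g * gi % p == 1) &&
  dlogChk p g dlog && (2 * h == p - 1) &&
  ((3 * (d * W.sum) ^ 2) ^ h < X : Bool) && ((W.sum ^ 2 * (p + 1)) ^ h < X : Bool) && (ms.length == p) &&
  ((List.range p).all fun s => tvalX p X M essL st (gNum p X wL wcL s) == some (ms.getD s 0)) &&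
  Fs.all fun F => normDatumX p X M d essL st esrL wL wcL PL F || LineUnit.datumChk p W F (excLookup F exc)


end LineNorm

end Summit.MatrixMultiplication.OmegaCensus
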